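/-
COR-CM (cell pub-hodgecm2, stage 2 of the Hodge ladder) — count-neutral junction «the MARKMAN COLUMN of the cyclic decic transport»
(seat prover-pub-hodgecm2-b09-g21-0, binder prover b09, gen 21; own lane DECIC-MARKMAN-TRANSPORT, HOME/lit/LIT-STATUS.md
2026-08-21T18:29:36Z, HOME/INBOX.md l.4703/l.4704).  Theorems only; no definition, no named fact, no `sorry`; nothing of seats
b23/b24/b30 or of the model layer is restated; `Interfaces.lean` (C1), every E term, `B01/*`, `Transposition/*` untouched.
HONEST FRAMING (COORDINATOR RULING — HODGE FRAMING CORRECTION, 2026-08-21T11:55:35Z): `HC_CM` is NOT proved, here or anywhere in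
the tree.  Everything below is CONDITIONAL on the displayed named fact `HodgeTheory.Markman2025_weilClasses_algebraic_hyperbolicSixfold`
(E. Markman, arXiv:2502.03415 Thm 1.5.1, UNREFEREED) — and, in §2, on Riemann's theorem `hR` and the realisation record `h₃`, which
§3 instantiates by the tree theorems `deligneMilne1982_Thm_6_20_full_holds`, `cmAbelianVarietyRealised_holds`.
T5 (coordinator ruling 15:33:56Z (3)): binder set of the closed §3 theorem = {Markman's named fact} ∪ dictionary data
(`h10`, `h2`, `i`, `hσ`, `hΨ`, `hΦ` — inhabited for every cyclic decic CM field: `DecicCurveFivefold.exists_generator_ten`, the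
quadratic subfield, the type `{τ̄}` of `k`, the half-circle type); one named fact, no second hypothesis binder of Prop sort beyond
data descriptions; no contradiction derivable; checker: self, 2026-08-21.
-/
import Summits.HodgeConjecture.CorCM.DecicCurveFivefoldHodgeOfMarkman
import Summits.HodgeConjecture.CorCM.DecicCurveFivefoldCyclicFrame
import Summits.HodgeConjecture.CorCM.CyclicSexticInducedType
import Summits.HodgeConjecture.CorCM.Model.CMSliceOfWeilFaces
import Literature.AlgebraicGeometry.ComplexMultiplication.ShimuraIsogenousPowerOfRiemann
import HarnessLib

/-!
# The Markman column of the cyclic decic census: `HC(A_{Θ_ind} × A_{Φ₀})` for the CHOSEN realisations, modulo Markman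

For a Galois (= cyclic) CM field `K` of degree `10`, a generator `σ` of `Gal(K/ℚ)`, a base embedding `p : K → ℂ`, an imaginary
quadratic field `k` with `i : k → K`, the CM type `Ψ = {τ}` of `k` with `τ = \\overline{p|_k}` and the HALF-CIRCLE type
`Φ₀ = {p ∘ σⁿ : n < 5}` of `K`, the tree's product abelian variety

  `Domination.cmProdAV K h₃ 1 ![Θ_ind, Φ₀] = A_{(K,Θ_ind)} × A_{(K,Φ₀)}`,  `Θ_ind = Ψ^K` the type INDUCED from `k`

(the CHOSEN realisations of the record `h₃`, read over `K` by `Domination.isCMTypeRealisation_cmCode`) satisfies the Hodge conjecture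
in every codimension, GIVEN ONLY Markman's hyperbolic-sixfold theorem (§2, modulo `hR`, `h₃`; §3 closed on the tree theorems).

Proof: `A_{(K,Θ_ind)}` realises the induced type, so Shimura's type inflation from Riemann's theorem
(`ComplexMultiplication.thm3_isogenousPower_of_riemann`) gives an isogeny `A_{(K,Θ_ind)} → E^h` onto a power of a realisation `E` of
`(k; {τ})` — a CM elliptic curve; hence `A_{(K,Θ_ind)} × A_{(K,Φ₀)}` is dominated by `⨁_j ![A_{(K,Φ₀)}, E] (κ j)` (§1, the
biproduct calculus of `CorCM/Model/CMProdBiproduct.lean`), and seat b09 gen 18's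
`DecicCurveFivefold.hodgeConjectureFor_of_avDominatedBy_comp_vec_of_halfCircle_of_markmanSixfold` (the Hodge conjecture for everything
dominated by a product of copies of the half-circle fivefold and the `k`-curve, modulo Markman; consumed in its FRAME form
`…_of_avDominatedBy_comp_of_frame_of_markmanSixfold` with the frame `DecicCurveFivefold.exists_cyclicFrame`) applies; the square
root `δ ∈ 𝓞_k`, `δ² = -d`, `τ(δ) = i√d` it wants exists in every imaginary quadratic field (§1 `exists_sqrt_neg_nat`).

USE.  This is the «known product» fed to the enlarged face transport `CorCM/FacePeriodsKnownProducts.lean` at degree `10`, cyclic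
type: the Lefschetz characters of the Hodge weights of `A_{Θ_ind} × A_{Φ₀}` (the pull-back of the Weil weight of the split sixfold
`E × B₀`) replace the third generating face of seat b30's census (`Census/DecicFaceTransportOfMarkman.lean`, filed separately).

References: [cite: Markman2025SecantWeil, Thm 1.5.1]; [cite: Shimura1998, §6.2 Theorem 3 and §8.4]; [cite: MumfordAV1970, §19];
[cite: DeligneMilne1982Tannakian, §6 Thm. 6.20 (Riemann), p. 212]; [cite: Pohlmann1968, Thm 1].
-/

noncomputable section

open CategoryTheory CategoryTheory.Limits NumberField
open Literature.AlgebraicGeometry Literature.AlgebraicGeometry.Motives Literature.AlgebraicGeometry.HodgeTheory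
open Literature.AlgebraicGeometry.ComplexMultiplication (IsCMTypeRealisation thm3_isogenousPower_of_riemann)
open Literature.NumberTheory.ComplexMultiplication (inducedCMType)
open Literature.NumberTheory.Automorphic.PicardCM (cmRealisation CMAbelianVarietyRealised)
open Summit.HodgeConjecture.CorCM.Domination
open Summit.HodgeConjecture.CorCM.CyclicSextic (emb)

namespace Summit.HodgeConjecture.CorCM.DecicInducedTimesHalfCircle

/-! ## §1 Two pieces of bookkeeping -/

/-- **`√-d` in an imaginary quadratic field, normalised at a given complex embedding**: for `[k:ℚ] = 2`, `k` CM, and any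
`τ : k → ℂ` there are `δ ∈ 𝓞_k` and `d ≥ 1` with `δ² = -d` and `τ(δ) = i√d` (the datum of b09 gen 18's cyclic frame;
`CyclicSextic.exists_sq_eq_neg_nat_of_isTotallyComplex` gives `δ² = -d`, and `τ(δ) = ±i√d` is fixed by the sign of `δ`).
[folklore] -/
theorem exists_sqrt_neg_nat (k : Type) [Field k] [NumberField k] [IsCMField k] (h2 : Module.finrank ℚ k = 2)
    (τ : k →+* ℂ) :
    ∃ (δ : 𝓞 k) (d : ℕ), 0 < d ∧ ((δ : k)) ^ 2 = -(d : k) ∧ τ (δ : k) = Complex.I * (Real.sqrt d : ℂ) := by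
  obtain ⟨δ, d, hd, hδ⟩ := CyclicSextic.exists_sq_eq_neg_nat_of_isTotallyComplex k h2
  have hw : (Complex.I * (Real.sqrt d : ℂ)) ^ 2 = -(d : ℂ) := by
    rw [mul_pow, Complex.I_sq, ← Complex.ofReal_pow, Real.sq_sqrt (Nat.cast_nonneg d)]
    push_cast
    ring
  have hz : (τ (δ : k)) ^ 2 = (Complex.I * (Real.sqrt d : ℂ)) ^ 2 := by
    rw [hw, ← map_pow, hδ, map_neg, map_natCast]
  rcases sq_eq_sq_iff_eq_or_eq_neg.mp hz with h | h
  · exact ⟨δ, d, hd, hδ, h⟩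
  · refine ⟨-δ, d, hd, ?_, ?_⟩
    · rw [show ((-δ : 𝓞 k) : k) = -(δ : k) from map_neg (algebraMap (𝓞 k) k) δ, neg_sq, hδ]
    · rw [show ((-δ : 𝓞 k) : k) = -(δ : k) from map_neg (algebraMap (𝓞 k) k) δ, map_neg, h, neg_neg]

/-- **Biproduct bookkeeping**: an isogeny `g : A → P` onto a product `P = ∏_{j<h} E` (a limit fan) makes `A × B` dominated by the
biproduct `⨁_{j ≤ h} ![B, E] (κ j)` with `κ j = 1` for `j < h`, `κ h = 0` — `P ≅ ⨁_{j<h} E` (uniqueness of limits), `– × B` (`prodCongrLeft`),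
`× = ⊞` (`AbelianVariety.biprodIsoProd`) and splitting off the last summand (`nonempty_biproduct_iso_biprod_castSucc`).
[cite: MumfordAV1970, §19] -/
theorem avDominatedBy_prod_biproduct_of_isogeny_fan {A P E : AbelianVariety ℂ} (B : AbelianVariety ℂ) {h : ℕ}
    {π : Fin h → (P ⟶ E)} (hlim : IsLimit (Fan.mk P π)) {g : A ⟶ P} (hg : AbelianVariety.IsIsogeny g) :
    AVDominatedBy (A.prod B)
      (⨁ fun j : Fin (h + 1) => (![B, E] : Fin 2 → AbelianVariety ℂ) (if (j : ℕ) < h then 1 else 0)) := by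
  classical
  -- `P ≅ ⨁_{j<h} E`
  let eP : P ≅ ⨁ (fun _ : Fin h => E) := hlim.conePointUniqueUpToIso (biproduct.isLimit (fun _ : Fin h => E))
  have h1 : AVDominatedBy A (⨁ fun _ : Fin h => E) :=
    (AVDominatedBy.of_isIsogeny_hom hg (AVDominatedBy.refl P)).of_iso_right eP
  have h2 : AVDominatedBy (A.prod B) ((⨁ fun _ : Fin h => E).prod B) := h1.prod (AVDominatedBy.refl B)
  -- `(⨁ E) × B ≅ (⨁ E) ⊞ B ≅ ⨁_{j ≤ h} f j`
  let f : Fin (h + 1) → AbelianVariety ℂ :=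
    fun j => (![B, E] : Fin 2 → AbelianVariety ℂ) (if (j : ℕ) < h then 1 else 0)
  have hf_cast : ∀ j : Fin h, f j.castSucc = E := fun j => by simp [f]
  have hf_last : f (Fin.last h) = B := by simp [f]
  obtain ⟨s⟩ := nonempty_biproduct_iso_biprod_castSucc (C := AbelianVariety ℂ) h f
  let e1 : (⨁ fun _ : Fin h => E) ≅ ⨁ fun j : Fin h => f j.castSucc := biproduct.mapIso fun j => eqToIso (hf_cast j).symm
  let e2 : B ≅ f (Fin.last h) := eqToIso hf_last.symm
  exact h2.of_iso_right ((AbelianVariety.biprodIsoProd _ _).symm ≪≫ biprod.mapIso e1 e2 ≪≫ s.symm)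

/-! ## §2 The Markman column, modulo `hR` and `h₃` -/

/-- **`HC(A_{(K,Θ_ind)} × A_{(K,Φ₀)})` for the chosen realisations, modulo Markman's sixfold theorem** (and `hR`, `h₃`).  `K` a
Galois CM field with `[K:ℚ] = 10`, `σ` a generator of `Gal(K/ℚ)`, `p : K → ℂ`, `k` CM with `[k:ℚ] = 2` and `i : k → K`, `Ψ` the
CM type `{\\overline{p ∘ i}}` of `k`, `Φ₀ = {p ∘ σⁿ : n < 5}`: every rational Hodge class on the tree's
`cmProdAV K h₃ 1 ![Ψ^K, Φ₀] = A_{(K,Ψ^K)} × A_{(K,Φ₀)}` is algebraic.  Displayed leaf: Markman's theorem; `hR`, `h₃` are tree theorems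
(§3). [cite: Markman2025SecantWeil, Thm 1.5.1] [cite: Shimura1998, §6.2 Theorem 3 and §8.4] [cite: MumfordAV1970, §19] -/
theorem hodgeConjectureFor_cmProdAV_induced_halfCircle_of_markmanSixfold_of_riemann
    (hM : Markman2025_weilClasses_algebraic_hyperbolicSixfold) (hR : DeligneMilne1982_Thm_6_20_full)
    (h₃ : CMAbelianVarietyRealised)
    {K : Type} [Field K] [NumberField K] [IsCMField K] [IsGalois ℚ K] (h10 : Module.finrank ℚ K = 10)
    {k : Type} [Field k] [NumberField k] [IsCMField k] (h2 : Module.finrank ℚ k = 2) (i : k →+* K)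
    {σ : K ≃ₐ[ℚ] K} (hσ : orderOf σ = 10) (p : K →+* ℂ)
    {Ψ : CMType k} (hΨ : ∀ t : k →+* ℂ, t ∈ Ψ.1 ↔ t = ComplexEmbedding.conjugate (p.comp i))
    {Φ : CMType K} (hΦ : ∀ s : K →+* ℂ, s ∈ Φ.1 ↔ ∃ n : ℕ, n < 5 ∧ s = emb σ p n) :
    HodgeConjectureFor (cmProdAV K h₃ 1 ![inducedCMType i Ψ, Φ]).dim (cmProdAV K h₃ 1 ![inducedCMType i Ψ, Φ]).X := by
  classical
  obtain ⟨δ, d, hd, hδ, hτ⟩ := exists_sqrt_neg_nat k h2 (ComplexEmbedding.conjugate (p.comp i))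
  have hp : p.comp i = ComplexEmbedding.conjugate (ComplexEmbedding.conjugate (p.comp i)) := (star_star _).symm
  -- the two chosen realisations, read over `K`
  have hA := isCMTypeRealisation_cmCode K h₃ (inducedCMType i Ψ)
  have hB := isCMTypeRealisation_cmCode K h₃ Φ
  -- Shimura's type inflation: `A_{(K,Ψ^K)} → E^h`
  obtain ⟨E, ιE, θE, hE, h, P, π, ⟨hlim⟩, g, hg, -⟩ := thm3_isogenousPower_of_riemann hR h₃ k K i Ψ _ _ _ hA
  have hdom : AVDominatedBy (cmProdAV K h₃ 1 ![inducedCMType i Ψ, Φ])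
      (⨁ fun j : Fin (h + 1) => (![(cmRealisation h₃ (cmCode K Φ)).AV, E] : Fin 2 → AbelianVariety ℂ)
        (if (j : ℕ) < h then 1 else 0)) :=
    avDominatedBy_prod_biproduct_of_isogeny_fan (cmRealisation h₃ (cmCode K Φ)).AV hlim hg
  -- the cyclic frame of `(K, σ, p)` and the two-slot family `Kf = (k, K)` (the intrinsic packaging of b09 gen 18's
  -- `DecicCurveFivefold.hodgeConjectureFor_biproduct_comp_vec_of_halfCircle_of_markmanSixfold`, frame form consumed by name)
  obtain ⟨e, he, he_sign, he_conj, he_gal⟩ := DecicCurveFivefold.exists_cyclicFrame h10 h2 hσ p i hd hτ hp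
  have hΦ' : ∀ s : K →+* ℂ, s ∈ Φ.1 ↔ (e s).val < 5 := by
    intro s
    rw [hΦ]
    constructor
    · rintro ⟨n, hn, rfl⟩
      rw [he, ZMod.val_natCast, Nat.mod_eq_of_lt (by omega)]
      exact hn
    · intro hs
      refine ⟨(e s).val, hs, ?_⟩
      apply e.injective
      rw [he, ZMod.natCast_zmod_val]
  let Kf : Fin 2 → Type := Fin.cons k fun _ : Fin 1 => K
  letI instF : ∀ j, Field (Kf j) := fun j =>
    Fin.cases (motive := fun j => Field (Kf j)) ‹Field k› (fun _ => ‹Field K›) j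
  letI instN : ∀ j, NumberField (Kf j) := fun j =>
    Fin.cases (motive := fun j => NumberField (Kf j)) ‹NumberField k› (fun _ => ‹NumberField K›) j
  haveI instC : ∀ j, IsCMField (Kf j) := fun j =>
    Fin.cases (motive := fun j => IsCMField (Kf j)) ‹IsCMField k› (fun _ => ‹IsCMField K›) j
  exact DecicCurveFivefold.hodgeConjectureFor_of_avDominatedBy_comp_of_frame_of_markmanSixfold (Kf := Kf) (i₀ := 0) (i₁ := 1)
    (A₂ := ![(cmRealisation h₃ (cmCode K Φ)).AV, E]) (Φ₂ := Fin.cons Φ (Fin.cons Ψ finZeroElim))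
    (ι₂ := Fin.cons _ (Fin.cons ιE finZeroElim)) (θ₂ := Fin.cons _ (Fin.cons θE finZeroElim)) hM _ h10 h2 i hd hδ hτ
    (Fin.cases hB (Fin.cases hE fun l => l.elim0)) e he_sign he_conj he_gal hΦ' hΨ hdom

/-! ## §3 CLOSED on the tree theorems (`hR`, `h₃` of record) -/

/-- **The Markman column of the cyclic decic census, CLOSED**: on the realisation record and Riemann's theorem OF RECORD
(`cmAbelianVarietyRealised_holds`, `deligneMilne1982_Thm_6_20_full_holds`) — the data fed by the enlarged face transport
(`CorCM/FacePeriodsKnownProducts.lean` §4): for a Galois CM field `K` of degree `10` the tree's product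
`cmProdAV K cmAbelianVarietyRealised_holds 1 ![Ψ^K, Φ₀]` satisfies the Hodge conjecture in every codimension, GIVEN ONLY Markman's
hyperbolic-sixfold theorem.  (FRAMING: conditional on that unrefereed theorem; `HC_CM` is not proved.)
[cite: Markman2025SecantWeil, Thm 1.5.1] [cite: Shimura1998, §6.2 Theorem 3 and §8.4] [cite: MumfordAV1970, §19] -/
theorem hodgeConjectureFor_cmProdAV_induced_halfCircle_of_markmanSixfold
    (hM : Markman2025_weilClasses_algebraic_hyperbolicSixfold)
    {K : Type} [Field K] [NumberField K] [IsCMField K] [IsGalois ℚ K] (h10 : Module.finrank ℚ K = 10)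
    {k : Type} [Field k] [NumberField k] [IsCMField k] (h2 : Module.finrank ℚ k = 2) (i : k →+* K)
    {σ : K ≃ₐ[ℚ] K} (hσ : orderOf σ = 10) (p : K →+* ℂ)
    {Ψ : CMType k} (hΨ : ∀ t : k →+* ℂ, t ∈ Ψ.1 ↔ t = ComplexEmbedding.conjugate (p.comp i))
    {Φ : CMType K} (hΦ : ∀ s : K →+* ℂ, s ∈ Φ.1 ↔ ∃ n : ℕ, n < 5 ∧ s = emb σ p n) :
    HodgeConjectureFor (cmProdAV K cmAbelianVarietyRealised_holds 1 ![inducedCMType i Ψ, Φ]).dim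
      (cmProdAV K cmAbelianVarietyRealised_holds 1 ![inducedCMType i Ψ, Φ]).X :=
  hodgeConjectureFor_cmProdAV_induced_halfCircle_of_markmanSixfold_of_riemann hM deligneMilne1982_Thm_6_20_full_holds
    cmAbelianVarietyRealised_holds h10 h2 i hσ p hΨ hΦ

end Summit.HodgeConjecture.CorCM.DecicInducedTimesHalfCircle

end
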